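import Summits.ValiantsHypothesis.ValiantsHypothesis.Theorems.LacunarySymmetroidMatrixDescartesDetLorentzianHessianPderiv
import Literature.AlgebraicGeometry.HyperbolicPolynomials.DerivativeCone
import Literature.AlgebraicGeometry.HyperbolicPolynomials.DeterminantalPencil
import Literature.AlgebraicGeometry.HyperbolicPolynomials.HyperbolicityConeComponent
import Literature.AlgebraicGeometry.HyperbolicPolynomials.Garding
import HarnessLib

/-!
# ValiantsHypothesis / LacunarySymmetroid — crux `MatrixDescartes` (stmt-ValiantsHypothesis-18050, V1),
# line `Cruxes/MatrixDescartes/Lines/lorentzian_shadow.lean`, stub `stub_detLorentzian`: conjunct (d)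
# (Lorentzian signature of the Hessians `hessAt (detArray m K A) γ`) for POSITIVE DEFINITE tuples, all `m, K`

For real symmetric positive definite `A_1, …, A_K ∈ Sym_m(ℝ)` let `P(s) = det(Σ_l s_l A_l)` (the line's
`detArray m K A` is its coefficient array; `P = detPencil A` of the tree's hyperbolic-polynomial library by
`rfl`).  Conjunct (d) of `IsLorentzianArray m K (detArray m K A)` asks, for every `γ ∈ Δ(m−2, K)`, that the
matrix `hessAt (detArray m K A) γ = ((γ+e_i+e_j)! · [s^{γ+e_i+e_j}] P)_{i,j}` have at most one positive
eigenvalue, in the line's reverse-Cauchy–Schwarz form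
`vᵀHv > 0 ⇒ (vᵀHv)(wᵀHw) ≤ (vᵀHw)²`.

`atMostOnePosEig_hessAt_detArray_of_posDef` proves it (statement UNFOLDED exactly as inside the line's
`IsLorentzianArray`, m-general copy of `DetLorentzianHessianTwo.atMostOnePosEig_hessAt_detArray_two`):
* `hessAt … γ` is the Hessian of `Q = ∂_L P` for any word `L` of `γ`
  (`DetLorentzianHessianPderiv.dotProduct_hessAt_mulVec(_self)`, val-lit-p4 g10);
* **Gårding–Rolle along the word through the definite cone** (`foldr_pderiv_hyperbolic`): with
  `C = {x : Σ x_j A_j ≻ 0}` (open, convex; `= Λ₊₊(P, e)` by `openHyperbolicityCone_detPencil`), the invariant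
  «`Q` is a form hyperbolic w.r.t. some `e ∈ C`, `Q(e) > 0`, and `C ⊆ Λ₊₊(Q, e)`» passes from `Q` to
  `∂_l Q = Σ_k (e_l)_k ∂_k Q` (`e_l ∈ C` since `A_l ≻ 0`): Gårding's switch of direction inside the cone
  (`IsHyperbolic.of_mem_openHyperbolicityCone`, `openHyperbolicityCone_eq_of_mem`), Rolle
  (`isHyperbolic_sum_smul_pderiv`), Euler `(∂_{e_l} Q)(e_l) = deg Q · Q(e_l) > 0`
  (`eval_sum_smul_pderiv_self`, eigenvalues of `e_l` positive), Renegar's nesting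
  `Λ₊(Q, e_l) ⊆ Λ₊(∂_{e_l} Q, e_l)` (`hyperbolicityCone_subset_sum_smul_pderiv`) upgraded to the open cones
  because `C` is open (`interior_hyperbolicityCone`);
* at the end `Q = ∂^γ P` is a hyperbolic quadratic with `Q(e) > 0`, and
  `DetLorentzianHyperbolicQuadratic.hyperbolic_quadratic_reverse_cauchy_schwarz` (val-lit-p4 g10) is the claim.
Degenerate cases (`K = 0`, `m < 2`) are vacuous (`H = 0`).

Helper of the item (`--supports stmt-ValiantsHypothesis-18050 --as helper`); 0 definitions, 0 named facts.
Honest framing: a tool on ONE conjunct of ONE stub of V1's unregistered alternative line; the singular (PSD) case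
of (d), `stub_detLorentzian` in general, the laws, `MatrixDescartes`, Conjecture B and `VP ≠ VNP` remain OPEN;
nothing here is progress on them.
-/

-- `Summit.ValiantsHypothesis.ValiantsHypothesis.…` is the tree's mandated single-conjunct layout (Sub = Summit).
set_option linter.dupNamespace false

noncomputable section

namespace Summit.ValiantsHypothesis.ValiantsHypothesis.Theorems.LacunarySymmetroidMatrixDescartes

open MvPolynomial Finset Matrix Literature.AlgebraicGeometry.HyperbolicPolynomials
open scoped BigOperators

namespace DetLorentzianHessianDefinite

variable {K : ℕ}

/-! ### Small bookkeeping -/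

/-- The coordinate vector `e_l` picks out the `l`-th summand. [folklore] -/
theorem sum_single_smul {M : Type*} [AddCommMonoid M] [Module ℝ M] (l : Fin K) (f : Fin K → M) :
    ∑ j, (Pi.single l (1 : ℝ) : Fin K → ℝ) j • f j = f l := by
  rw [Finset.sum_eq_single l]
  · rw [Pi.single_eq_same, one_smul]
  · intro j _ hj; rw [Pi.single_eq_of_ne hj, zero_smul]
  · intro h; exact absurd (Finset.mem_univ l) h

/-- The directional derivative in direction `e_l` is the partial derivative `∂_l`. [folklore] -/
theorem sum_single_smul_pderiv (l : Fin K) (Q : MvPolynomial (Fin K) ℝ) :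
    ∑ k, (Pi.single l (1 : ℝ) : Fin K → ℝ) k • MvPolynomial.pderiv k Q = MvPolynomial.pderiv l Q :=
  sum_single_smul l fun k => MvPolynomial.pderiv k Q

/-- Every multi-index `γ : Fin K → ℕ` is the letter count of a word of length `Σ γ`. [folklore] -/
theorem exists_word (γ : Fin K → ℕ) :
    ∃ L : List (Fin K), (∀ a, L.count a = γ a) ∧ L.length = ∑ i, γ i := by
  classical
  refine ⟨((Finsupp.equivFunOnFinite.symm γ).toMultiset).toList, fun a => ?_, ?_⟩
  · rw [← Multiset.coe_count, Multiset.coe_toList, Finsupp.count_toMultiset,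
      Finsupp.coe_equivFunOnFinite_symm]
  · rw [Multiset.length_toList, Finsupp.card_toMultiset, Finsupp.sum_fintype _ _ (fun _ => rfl)]
    simp only [Finsupp.coe_equivFunOnFinite_symm, id]

/-- A positive definite real matrix is symmetric. [folklore] -/
theorem isSymm_of_posDef {m : ℕ} {M : Matrix (Fin m) (Fin m) ℝ} (hM : M.PosDef) : M.IsSymm := by
  have h := hM.isHermitian
  unfold Matrix.IsHermitian at h
  rwa [Matrix.conjTranspose_eq_transpose_of_trivial] at h

/-! ### Gårding–Rolle along a word, through the positive definite cone -/

/-- **Gårding–Rolle induction.**  For positive definite symmetric `A_l` and a word `L` of length `< m`, the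
iterated partial derivative `Q = ∂_L P` of `P = det(Σ s_l A_l)` is a form of degree `m − |L|`, hyperbolic with
respect to some `e` of the definite cone `C = {x : Σ x_j A_j ≻ 0}`, with `Q(e) > 0` and `C ⊆ Λ₊₊(Q, e)`.
[folklore] -/
theorem foldr_pderiv_hyperbolic {m : ℕ} (A : Fin K → Matrix (Fin m) (Fin m) ℝ) (hA : ∀ l, (A l).PosDef)
    (e₀ : Fin K → ℝ) (he₀ : (∑ j, e₀ j • A j).PosDef) :
    ∀ L : List (Fin K), L.length < m →
      ∃ e : Fin K → ℝ, (∑ j, e j • A j).PosDef ∧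
        IsHyperbolic (L.foldr (fun l g => MvPolynomial.pderiv l g) (detPencil A)) e ∧
        0 < MvPolynomial.eval e (L.foldr (fun l g => MvPolynomial.pderiv l g) (detPencil A)) ∧
        (L.foldr (fun l g => MvPolynomial.pderiv l g) (detPencil A)).IsHomogeneous (m - L.length) ∧
        {x : Fin K → ℝ | (∑ j, x j • A j).PosDef} ⊆
          openHyperbolicityCone (L.foldr (fun l g => MvPolynomial.pderiv l g) (detPencil A)) e := by
  classical
  have hsymm : ∀ l, (A l).IsSymm := fun l => isSymm_of_posDef (hA l)
  have hPhom : (detPencil A).IsHomogeneous m := by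
    simpa only [Fintype.card_fin] using isHomogeneous_detPencil A
  have hCopen : IsOpen {x : Fin K → ℝ | (∑ j, x j • A j).PosDef} := by
    rw [← openHyperbolicityCone_detPencil hsymm he₀]
    exact (isHyperbolic_detPencil hsymm he₀).isOpen_openHyperbolicityCone hPhom
  intro L
  induction L with
  | nil =>
    intro _
    refine ⟨e₀, he₀, isHyperbolic_detPencil hsymm he₀, eval_detPencil_pos he₀, ?_, ?_⟩
    · simpa only [List.foldr_nil, List.length_nil, Nat.sub_zero] using hPhom
    · rw [List.foldr_nil, openHyperbolicityCone_detPencil hsymm he₀]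
  | cons l L ih =>
    intro hlen
    rw [List.length_cons] at hlen
    obtain ⟨e, -, hQe, hQpos, hQhom, hCsub⟩ := ih (by omega)
    set Q := L.foldr (fun l g => MvPolynomial.pderiv l g) (detPencil A) with hQdef
    have hd1 : 1 ≤ m - L.length := by omega
    set el : Fin K → ℝ := Pi.single l 1 with hel
    have helC : (∑ j, el j • A j).PosDef := by rw [hel, sum_single_smul]; exact hA l
    have helcone : el ∈ openHyperbolicityCone Q e := hCsub helC
    have hQel : IsHyperbolic Q el := hQe.of_mem_openHyperbolicityCone hQhom helcone
    have hcone_eq : openHyperbolicityCone Q el = openHyperbolicityCone Q e :=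
      openHyperbolicityCone_eq_of_mem hQhom hQe helcone
    have hQel_pos : 0 < MvPolynomial.eval el Q := by
      rw [eval_eq_eval_mul_prod_eigenvalues hQhom hQe el]
      refine mul_pos hQpos (Multiset.prod_pos fun lam hlam => ?_)
      exact (mem_openHyperbolicityCone_iff_eigenvalues_pos hQhom hQe el).1 helcone lam hlam
    -- the derivative `∂_l Q = Σ_k (e_l)_k ∂_k Q`
    have hfold : (l :: L).foldr (fun l g => MvPolynomial.pderiv l g) (detPencil A) =
        ∑ k, el k • MvPolynomial.pderiv k Q := by
      rw [List.foldr_cons, hel, sum_single_smul_pderiv]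
    have hQ'hyp : IsHyperbolic (∑ k, el k • MvPolynomial.pderiv k Q) el :=
      isHyperbolic_sum_smul_pderiv hQhom hQel hd1
    have hQ'hom : (∑ k, el k • MvPolynomial.pderiv k Q).IsHomogeneous (m - (L.length + 1)) := by
      have hm : m - (L.length + 1) + (l :: L).length = m := by rw [List.length_cons]; omega
      have h := DetLorentzianHessianPderiv.isHomogeneous_foldr_pderiv (l :: L) (m - (L.length + 1))
        (detPencil A) (by rw [hm]; exact hPhom)
      rwa [hfold] at h
    have hQ'pos : 0 < MvPolynomial.eval el (∑ k, el k • MvPolynomial.pderiv k Q) := by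
      rw [eval_sum_smul_pderiv_self hQhom el]
      exact mul_pos (by exact_mod_cast hd1) hQel_pos
    have hCsub' : {x : Fin K → ℝ | (∑ j, x j • A j).PosDef} ⊆
        openHyperbolicityCone (∑ k, el k • MvPolynomial.pderiv k Q) el := by
      have h1 : {x : Fin K → ℝ | (∑ j, x j • A j).PosDef} ⊆
          hyperbolicityCone (∑ k, el k • MvPolynomial.pderiv k Q) el := by
        intro x hx
        have hx1 : x ∈ openHyperbolicityCone Q el := by rw [hcone_eq]; exact hCsub hx
        exact hyperbolicityCone_subset_sum_smul_pderiv hQhom hQel hd1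
          (openHyperbolicityCone_subset Q el hx1)
      have h2 := interior_maximal h1 hCopen
      rwa [interior_hyperbolicityCone hQ'hom hQ'hyp] at h2
    refine ⟨el, helC, ?_, ?_, ?_, ?_⟩
    · rw [hfold]; exact hQ'hyp
    · rw [hfold]; exact hQ'pos
    · rw [hfold, List.length_cons]; exact hQ'hom
    · rw [hfold]; exact hCsub'

/-! ### Conjunct (d) for definite tuples -/

/-- **Conjunct (d) of `IsLorentzianArray m K (detArray m K A)` for positive definite symmetric tuples, all
`m, K`** (statement UNFOLDED exactly as in the line file: `γ ∈ layer (m−2) K`, the matrix is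
`hessAt (detArray m K A) γ`, the conclusion is `AtMostOnePosEig`): if `A_l ≻ 0` for all `l`, then for every
`γ` with `|γ| = m − 2` and all `v, w`, `vᵀHv > 0 ⇒ (vᵀHv)(wᵀHw) ≤ (vᵀHw)²` for
`H = ((γ+e_i+e_j)!·[s^{γ+e_i+e_j}] det(Σ s_l A_l))_{i,j}` — the Hessian of the hyperbolic quadratic `∂^γ P`
(Gårding 1959 / Renegar 2006 along a word of `γ`; reverse Cauchy–Schwarz for Lorentzian quadratics).
[folklore] -/
theorem atMostOnePosEig_hessAt_detArray_of_posDef (m K : ℕ) (A : Fin K → Matrix (Fin m) (Fin m) ℝ)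
    (hA : ∀ l, (A l).PosDef) :
    ∀ γ ∈ (Fintype.piFinset fun _ : Fin K => Finset.range (m - 2 + 1)).filter (fun α => ∑ i, α i = m - 2),
      ∀ v w : Fin K → ℝ,
        0 < v ⬝ᵥ ((fun i j : Fin K =>
              ((∏ k, ((γ + Pi.single i 1 + Pi.single j 1 : Fin K → ℕ) k).factorial : ℕ) : ℝ) *
                MvPolynomial.coeff (Finsupp.equivFunOnFinite.symm (γ + Pi.single i 1 + Pi.single j 1))
                  (Matrix.det (∑ l, (MvPolynomial.X l : MvPolynomial (Fin K) ℝ) • (A l).map MvPolynomial.C)))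
            *ᵥ v) →
          (v ⬝ᵥ ((fun i j : Fin K =>
              ((∏ k, ((γ + Pi.single i 1 + Pi.single j 1 : Fin K → ℕ) k).factorial : ℕ) : ℝ) *
                MvPolynomial.coeff (Finsupp.equivFunOnFinite.symm (γ + Pi.single i 1 + Pi.single j 1))
                  (Matrix.det (∑ l, (MvPolynomial.X l : MvPolynomial (Fin K) ℝ) • (A l).map MvPolynomial.C)))
            *ᵥ v)) *
            (w ⬝ᵥ ((fun i j : Fin K =>
              ((∏ k, ((γ + Pi.single i 1 + Pi.single j 1 : Fin K → ℕ) k).factorial : ℕ) : ℝ) *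
                MvPolynomial.coeff (Finsupp.equivFunOnFinite.symm (γ + Pi.single i 1 + Pi.single j 1))
                  (Matrix.det (∑ l, (MvPolynomial.X l : MvPolynomial (Fin K) ℝ) • (A l).map MvPolynomial.C)))
            *ᵥ w)) ≤
          (v ⬝ᵥ ((fun i j : Fin K =>
              ((∏ k, ((γ + Pi.single i 1 + Pi.single j 1 : Fin K → ℕ) k).factorial : ℕ) : ℝ) *
                MvPolynomial.coeff (Finsupp.equivFunOnFinite.symm (γ + Pi.single i 1 + Pi.single j 1))
                  (Matrix.det (∑ l, (MvPolynomial.X l : MvPolynomial (Fin K) ℝ) • (A l).map MvPolynomial.C)))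
            *ᵥ w)) ^ 2 := by
  classical
  intro γ hγ v w hv
  -- `K = 0`: all forms vanish
  rcases Nat.eq_zero_or_pos K with hK | hK
  · subst hK
    exfalso
    simp [dotProduct] at hv
  rw [Finset.mem_filter] at hγ
  obtain ⟨-, hγsum⟩ := hγ
  set P : MvPolynomial (Fin K) ℝ :=
    Matrix.det (∑ l, (MvPolynomial.X l : MvPolynomial (Fin K) ℝ) • (A l).map MvPolynomial.C) with hP
  have hPdef : P = detPencil A := rfl
  have hPhom : P.IsHomogeneous m := by
    rw [hPdef]; simpa only [Fintype.card_fin] using isHomogeneous_detPencil A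
  -- `m < 2`: `H = 0`
  by_cases hm : m < 2
  · exfalso
    have hzero : ∀ i j : Fin K,
        MvPolynomial.coeff (Finsupp.equivFunOnFinite.symm (γ + Pi.single i 1 + Pi.single j 1)) P = 0 := by
      intro i j
      refine hPhom.coeff_eq_zero ?_
      rw [Finsupp.degree_eq_sum]
      simp only [Finsupp.coe_equivFunOnFinite_symm, Pi.add_apply, Finset.sum_add_distrib, hγsum]
      rw [Finset.sum_pi_single' i 1, Finset.sum_pi_single' j 1]
      simp only [Finset.mem_univ, if_true]
      omega
    have hH : (fun i j : Fin K =>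
        ((∏ k, ((γ + Pi.single i 1 + Pi.single j 1 : Fin K → ℕ) k).factorial : ℕ) : ℝ) *
          MvPolynomial.coeff (Finsupp.equivFunOnFinite.symm (γ + Pi.single i 1 + Pi.single j 1)) P) =
        (0 : Matrix (Fin K) (Fin K) ℝ) := by
      ext i j
      rw [Matrix.zero_apply, hzero i j, mul_zero]
    rw [hH, Matrix.zero_mulVec, dotProduct_zero] at hv
    exact lt_irrefl _ hv
  rw [not_lt] at hm
  -- a word of `γ`
  obtain ⟨L, hLcount, hLlen⟩ := exists_word γ
  have hLm : L.length + 2 = m := by rw [hLlen, hγsum]; omega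
  have hPhom' : P.IsHomogeneous (L.length + 2) := by rw [hLm]; exact hPhom
  -- the forms are values of `Q = ∂_L P`
  rw [DetLorentzianHessianPderiv.dotProduct_hessAt_mulVec_self P L γ hLcount hPhom' v] at hv ⊢
  rw [DetLorentzianHessianPderiv.dotProduct_hessAt_mulVec_self P L γ hLcount hPhom' w,
    DetLorentzianHessianPderiv.dotProduct_hessAt_mulVec P L γ hLcount hPhom' v w]
  have hQv : 0 < MvPolynomial.eval v (L.foldr (fun l g => MvPolynomial.pderiv l g) P) := by linarith
  -- Gårding–Rolle: `Q` is a hyperbolic quadratic, positive at some point of the definite cone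
  obtain ⟨e, -, hQe, hQpos, hQhom, -⟩ := foldr_pderiv_hyperbolic A hA (Pi.single ⟨0, hK⟩ 1)
    (by rw [sum_single_smul]; exact hA _) L (by omega)
  rw [← hPdef] at hQe hQpos hQhom
  have hQ2 : (L.foldr (fun l g => MvPolynomial.pderiv l g) P).IsHomogeneous 2 := by
    rwa [show m - L.length = 2 by omega] at hQhom
  have key := DetLorentzianHyperbolicQuadratic.hyperbolic_quadratic_reverse_cauchy_schwarz hQ2 hQe hQpos
    v w hQv
  calc 2 * MvPolynomial.eval v (L.foldr (fun l g => MvPolynomial.pderiv l g) P) *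
        (2 * MvPolynomial.eval w (L.foldr (fun l g => MvPolynomial.pderiv l g) P))
      = 4 * MvPolynomial.eval v (L.foldr (fun l g => MvPolynomial.pderiv l g) P) *
          MvPolynomial.eval w (L.foldr (fun l g => MvPolynomial.pderiv l g) P) := by ring
    _ ≤ _ := key

end DetLorentzianHessianDefinite

end Summit.ValiantsHypothesis.ValiantsHypothesis.Theorems.LacunarySymmetroidMatrixDescartes

end
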